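import Literature.Topology.FourManifolds.ExoticSevenSphereSignature
import Literature.Topology.FourManifolds.HomotopySpheresIsMulExists
import Literature.Topology.FourManifolds.HomotopySpheresProofs
import Literature.Topology.FourManifolds.SpinProofs
import Literature.Topology.FourManifolds.StableFramingLift
import Literature.Topology.FourManifolds.MapsToSphereNullhomotopic
import Literature.Topology.FourManifolds.ClosedModelConeOrientation
import Literature.Topology.FourManifolds.ParallelizableOrientation
import HarnessLib

/-!
# Kervaire–Milnor's Theorem 7.5, the direction "h-cobordant ⇒ `σ(M₁) ≡ σ(M₂) mod σₘ`", reduced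

Sibling proof file of `HomotopySpheresSignature.lean`, which vendors Kervaire–Milnor's Thm. 7.5
(*Groups of homotopy spheres I*, Ann. of Math. 77 (1963), pp. 529–530) on classes as the named
fact `Literature.Topology.FourManifolds.HomotopySphere.mk_eq_mk_iff_sigmaGen_dvd_sub`:
"Let `Σ₁` and `Σ₂` be homotopy spheres of dimension `4m - 1`, `m > 1`, which bound
s-parallelizable manifolds `M₁` and `M₂` respectively. Then `Σ₁` is h-cobordant to `Σ₂` if and
only if `σ(M₁) ≡ σ(M₂) mod σₘ`."

The printed proof has two halves of very different weight.

* "**if**" (p. 529–530): form `(-M₁, -bM₁) # (M₂, bM₂) # (M₀, bM₀)` with `σ = 0` and apply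
  **Lemma 7.3** (a framed `4m`-manifold, `4m > 4`, bounded by a homology sphere can be surgered to
  a contractible one iff `σ = 0` — §§5–7, Milnor's surgery), then Lemma 2.3. Lemma 7.3 is not in
  the tree; this half is not touched here.
* "**only if**" (p. 530): "Conversely let `W` be an h-cobordism between `-Σ₁ # Σ₂` and the sphere
  `S⁴ᵐ⁻¹`. Pasting `W` onto `(-M₁) # M₂` along the common boundary `-Σ₁ # Σ₂`, we obtain a
  differentiable manifold `M` bounded by the sphere `S⁴ᵐ⁻¹`. Since `M` is clearly
  s-parallelizable, we have `σ(M) ≡ 0 (mod σₘ)`. But `σ(M) = -σ(M₁) + σ(M₂)`."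

This file **proves** the "only if" half from named facts the tree already has, all at the level
of Kervaire–Milnor's printed ingredients (no new named fact, D-0026):

* an `IsMul`-compatible commutative group structure on `Θₙ` with unit `[𝕊ⁿ]` and inverse
  `[Σ] ↦ [-Σ]` — Kervaire–Milnor's Thm. 1.1, the named fact
  `Literature.Topology.FourManifolds.exists_commGroup_homotopySphereClass` (or any such structure,
  `HomotopySphere.sigmaGen_dvd_sub_of_mk_eq_mk_of_commGroup`);
* `σ(-M) = -σ(M)`, `b(-M) = -bM` — `HomotopySphere.neg_mem_signatureSet_neg`
  (`HomotopySpheresBPOrderSignatureLeaves.lean`; Kervaire–Milnor §2 and "`(-M₁, -bM₁)`", p. 530;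
  proved in the tree from Milnor's Prop. B, `HomotopySphere.neg_mem_signatureSet_neg_of_propB`);
* additivity of `σ` over the connected sum along the boundary, which is again s-parallelizable —
  `HomotopySphere.add_mem_signatureSet_of_isOrientedConnectedSum` (§2 pp. 506–508 and the first
  lines of the proof of Thm. 7.5: "`σ(M) = -σ(M₁) + σ(M₂)`", "`M` is clearly s-parallelizable");
* Bredon's VI.7.15 on the standard sphere, `SmoothOrientation.existsUnique_isCompatible n 𝕊ⁿ`,
  through the tree theorem `HomotopySphere.exists_mem_signatureSet_sphere_of_diffeomorph`
  (`ExoticSevenSphereSignature.lean`): the tacit invariance of "`σ(M)` for `M` bounded by *the*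
  `(4m-1)`-sphere" under diffeomorphisms of that sphere (p. 529, definition of `σₘ`).

Since the tree's `Θₙ = HomotopySphereClass n` is the quotient by oriented diffeomorphism (which is
Kervaire–Milnor's h-cobordism quotient for `n = 4m - 1 ≥ 7`, Smale), no h-cobordism `W` has to be
pasted: `[Σ₁] = [Σ₂]` gives `[-Σ₁ # Σ₂] = [-Σ₁] · [Σ₂] = [Σ₁]⁻¹ · [Σ₁] = 1 = [𝕊ⁿ]`, so `-Σ₁ # Σ₂` is
*diffeomorphic* to `𝕊ⁿ` (`HomotopySphereClass.nonempty_diffeomorph_of_mk_eq_mk`, a chain of oriented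
diffeomorphisms composes to a diffeomorphism — no appeal to `HomotopySphereClass.mk_eq_mk_iff`), and
`(-M₁) # M₂`, of signature `-σ(M₁) + σ(M₂)`, is transported along this diffeomorphism to an
oriented s-parallelizable manifold bounded by `(𝕊ⁿ, o)` for some orientation `o`. Its signature
then lies in the subgroup generated by all such signatures
(`HomotopySphere.sphereSignatureSubgroup`), every element of which is a multiple of Kervaire–Milnor's
`σₘ = HomotopySphere.sigmaGen g m h` — the least positive element — by Euclidean division
(`HomotopySphere.sigmaGen_dvd_of_mem_sphereSignatureSubgroup`,
`HomotopySphere.sphereSignatureSubgroup_eq_zmultiples`: "Let `σₘ > 0` denote the generator of this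
group", p. 529). The connected sum `-Σ₁ # Σ₂` exists as a homotopy sphere unconditionally for
`n ≠ 2` (`HomotopySphere.exists_isOrientedConnectedSum_of_ne_two`, from the tree theorems
`exists_isOrientedConnectedSum_holds` and
`HomotopySphere.nonempty_homotopyEquiv_sphere_of_isConnectedSum_of_ne_two`).

## Main statements (all proved)

* `HomotopySphere.sigmaGen_dvd_of_mem_sphereSignatureSubgroup`,
  `HomotopySphere.sigmaGen_mem_sphereSignatureSubgroup`,
  `HomotopySphere.sphereSignatureSubgroup_eq_zmultiples`: `σₘ` generates Kervaire–Milnor's group of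
  signatures (p. 529).
* `HomotopySphereClass.nonempty_diffeomorph_of_mk_eq_mk`: equal classes in `Θₙ` have diffeomorphic
  representatives.
* `HomotopySphere.exists_isOrientedConnectedSum_of_ne_two`: oriented connected sums of homotopy
  `n`-spheres exist as homotopy spheres, `n ≠ 0, 2`.
* `HomotopySphere.sigmaGen_dvd_sub_of_mk_eq_mk_of_commGroup`: Thm. 7.5 "only if" for a given
  `IsMul`-compatible group structure on `Θₙ`, from the three remaining facts;
  `HomotopySphere.sigmaGen_dvd_sub_of_mk_eq_mk_of_groupLawFacts`: the same from the class-level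
  group laws `HomotopySphereClass.GroupLawFacts n` (Lemmas 2.1–2.4, Smale).
* `HomotopySphere.sigmaGen_dvd_sub_of_mk_eq_mk_of`: Thm. 7.5 "only if" in the binder shape of
  `mk_eq_mk_iff_sigmaGen_dvd_sub`, from Thm. 1.1 and the three facts;
  `HomotopySphere.sigmaGen_dvd_sub_of_mk_eq_mk_of_propB`: the same with `σ(-M) = -σ(M)` replaced by
  Milnor's Prop. B (`nonempty_homeomorph_sphere_of_homologySphere_of_five_le`), from which the tree
  proves it.

What is NOT here: the "if" half (Lemma 7.3, surgery), hence no discharge of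
`mk_eq_mk_iff_sigmaGen_dvd_sub` itself.

## Kervaire–Milnor's Lemma 3.4: discharge of `boundsParallelizable_of_mem_signatureSet` (appended)

This file also discharges the named fact
`Literature.Topology.FourManifolds.HomotopySphere.boundsParallelizable_of_mem_signatureSet`
(`HomotopySpheresSignature.lean`): if `σ ∈ signatureSet g m h Σ`, i.e. the homotopy `n`-sphere `Σ`
(`n + 1 = 4m`) bounds a compact **s-parallelizable** manifold `M` (as an oriented manifold, with
signature `σ`), then `Σ` bounds a **parallelizable** manifold
(`HomotopySphere.BoundsParallelizable`, the definition of Kervaire–Milnor's `bPₙ₊₁`, §4) —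
`HomotopySphere.boundsParallelizable_of_mem_signatureSet_holds`.

The source is Kervaire–Milnor's **Lemma 3.4** (p. 509): "*A connected manifold with non-vacuous
boundary is s-parallelizable if and only if it is parallelizable*", whose printed proof is "This
follows by a similar argument [to Lemma 3.5: the classifying map of the stable trivialisation into
`γᵏ → Sᵏ` is null-homotopic, hence `ξ` is trivial]. The hypothesis on the manifold guarantees that
every map into a sphere of the same dimension is null-homotopic." The two halves of that argument
are the tree files `StableFramingLift.lean` (a stable framing whose Gauss map `â : W → Sᵏ` is
null-homotopic yields a framing, by a discrete covering homotopy for `O(k+1) → Sᵏ`) and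
`MapsToSphereNullhomotopic.lean` (every map from a compact connected manifold with non-empty
boundary to a sphere of at least its dimension is null-homotopic, by collar pushes and discs); here
they are assembled:

* `NullCobordism.isParallelizable_of_isStablyParallelizable` — **Lemma 3.4** for the total space
  of a null-cobordism `M = ∂W` (`W` compact connected, `M ≠ ∅` closed): s-parallelizable implies
  parallelizable;
* `NullCobordism.exists_connectedSpace_isStablyParallelizable` — the reduction "applied to the
  component of `M` containing `bM = Σ`, which is again a null-cobordism of `Σ`" of the docstring
  of the fact: the connected component of `∂W` in `W` is an open-and-closed submanifold, a
  null-cobordism of the (connected) boundary, and inherits the stable framing (`TW₀ = TW|_{W₀}`,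
  `HasStableTangentFramingAlong.of_comp_subtype_val`). This step is necessary: a closed component
  of an s-parallelizable `M` need not be parallelizable (`S⁴ᵐ`).

These are proved outright (no definitions, no named facts used); Kervaire–Milnor 1963, Lemma 3.4
and Lemma 3.5 (p. 509), §4 (definition of `bPₙ₊₁`).

## Kervaire–Milnor §4/§7: discharge of `nonempty_signatureSet_of_boundsParallelizable` (appended)

This file finally discharges
`Literature.Topology.FourManifolds.HomotopySphere.nonempty_signatureSet_of_boundsParallelizable`
(`HomotopySphere.nonempty_signatureSet_of_boundsParallelizable_holds`): a homotopy sphere bounding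
a parallelizable manifold bounds an oriented s-parallelizable one, unconditionally (no manifold
structure on the closed model is needed: `ClosedModelConeOrientation.lean`). See the section
docstring `NonemptySignatureSetAppended` below.

## References

* M. Kervaire, J. Milnor, *Groups of homotopy spheres I*, Ann. of Math. 77 (1963): §2 (pp. 505–508),
  §7: p. 529 (definition of `σₘ`), Thm. 7.5 and its proof (pp. 529–530). [KervaireMilnorAnnals1963]
* G. Bredon, *Topology and Geometry* (1993), VI.7, Thm. 7.15. [Bredon1993]
* J. Milnor, *Lectures on the h-cobordism theorem* (1965), §9, Prop. B (p. 109). [MilnorHCobordism1965]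
-/

open scoped Manifold ContDiff Topology
open Set Function

noncomputable section

namespace Literature.Topology.FourManifolds

/-! ### Equal classes have diffeomorphic representatives -/

namespace HomotopySphereClass

variable {n : ℕ}

/-- **Equal classes in `Θₙ` have diffeomorphic representatives.** `Θₙ = HomotopySphereClass n` is
the `Quot` of `HomotopySphere n` by oriented diffeomorphism, so `[Σ] = [Σ']` means that `Σ` and
`Σ'` are joined by a chain of oriented diffeomorphisms and their inverses (`Quot.eqvGen_exact`);
composing the underlying diffeomorphisms gives a diffeomorphism `Σ ≅ Σ'` (orientation is not
tracked, so the named fact `HomotopySphereClass.mk_eq_mk_iff` is not needed). Kervaire–Milnor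
1963, §1 (`Θₙ` as diffeomorphism classes, p. 505). [cite: KervaireMilnorAnnals1963, §1, p. 505] -/
theorem nonempty_diffeomorph_of_mk_eq_mk {S T : HomotopySphere n} (hST : mk S = mk T) :
    Nonempty (S.carrier ≃ₘ⟮𝓡 n, 𝓡 n⟯ T.carrier) := by
  have key : ∀ {A B : HomotopySphere n}, Relation.EqvGen HomotopySphere.IsOrientedDiffeomorphic A B →
      Nonempty (A.carrier ≃ₘ⟮𝓡 n, 𝓡 n⟯ B.carrier) := by
    intro A B hAB
    induction hAB with
    | rel _ _ h =>
      obtain ⟨φ, -⟩ := h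
      exact ⟨φ⟩
    | refl _ => exact ⟨Diffeomorph.refl _ _ _⟩
    | symm _ _ _ ih => exact ⟨ih.some.symm⟩
    | trans _ _ _ _ _ ih₁ ih₂ => exact ⟨ih₁.some.trans ih₂.some⟩
  exact key (Quot.eqvGen_exact hST)

end HomotopySphereClass

namespace HomotopySphere

variable {n : ℕ}

/-! ### `σₘ` generates the group of signatures (Kervaire–Milnor p. 529) -/

/-- **Every signature in Kervaire–Milnor's group is a multiple of `σₘ`**: each element of the
subgroup `sphereSignatureSubgroup g m h ⊆ ℤ` (generated by the signatures of the oriented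
s-parallelizable manifolds bounded by the standard sphere) is divisible by its least positive
element `σₘ = sigmaGen g m h` — Euclidean division: the remainder is a non-negative element of the
subgroup below `σₘ`, hence `0` (and if the subgroup is trivial both sides vanish). Kervaire–Milnor
1963, p. 529: "Clearly the corresponding signatures `σ(M₀) ∈ ℤ` form a group under addition. Let
`σₘ > 0` denote the generator of this group"; used on p. 530 as "`σ(M) ≡ 0 (mod σₘ)`". [cite: KervaireMilnorAnnals1963, §7, p. 529 (definition of σₘ) and p. 530] -/
theorem sigmaGen_dvd_of_mem_sphereSignatureSubgroup {g : Literature.AlgebraicTopology.SingularHomology.HomologicalOrientation ℤ (EuclideanSpace ℝ (Fin n)) n}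
    {m : ℕ} {h : n + 1 = 4 * m} {x : ℤ} (hx : x ∈ sphereSignatureSubgroup g m h) :
    (sigmaGen g m h : ℤ) ∣ x := by
  by_cases hx0 : x = 0
  · simp [hx0]
  obtain ⟨hpos, hmem⟩ := sigmaGen_pos_and_mem hx hx0
  set d : ℕ := sigmaGen g m h with hd
  have hdpos : (0 : ℤ) < d := by exact_mod_cast hpos
  -- the remainder of `x` modulo `d` lies in the subgroup
  have hr : x % (d : ℤ) ∈ sphereSignatureSubgroup g m h := by
    rw [Int.emod_def]
    refine sub_mem hx ?_
    rw [mul_comm, ← smul_eq_mul]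
    exact AddSubgroup.zsmul_mem _ hmem _
  have hr0 : 0 ≤ x % (d : ℤ) := Int.emod_nonneg _ hdpos.ne'
  have hrd : x % (d : ℤ) < d := Int.emod_lt_of_pos _ hdpos
  by_contra hndvd
  have hne : x % (d : ℤ) ≠ 0 := fun h0 => hndvd (Int.dvd_of_emod_eq_zero h0)
  -- so it would be a positive element of the subgroup below the least one
  have hcast : (((x % (d : ℤ)).toNat : ℕ) : ℤ) = x % (d : ℤ) := Int.toNat_of_nonneg hr0
  have hmemset : (x % (d : ℤ)).toNat ∈
      {k : ℕ | 0 < k ∧ (k : ℤ) ∈ sphereSignatureSubgroup g m h} := by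
    refine ⟨?_, ?_⟩
    · have : (0 : ℤ) < ((x % (d : ℤ)).toNat : ℕ) := by
        rw [hcast]; exact lt_of_le_of_ne hr0 (Ne.symm hne)
      exact_mod_cast this
    · rw [hcast]; exact hr
  have hle : d ≤ (x % (d : ℤ)).toNat := Nat.sInf_le hmemset
  have hle' : (d : ℤ) ≤ ((x % (d : ℤ)).toNat : ℕ) := by exact_mod_cast hle
  rw [hcast] at hle'
  exact absurd hrd (not_lt.2 hle')

/-- **`σₘ` lies in the group of signatures**: `(sigmaGen g m h : ℤ) ∈ sphereSignatureSubgroup g m h`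
(the least positive element when the subgroup is nontrivial, `sigmaGen_pos_and_mem`; the junk
value `0` when it is trivial). Kervaire–Milnor 1963, p. 529 ("the generator of this group"). [cite: KervaireMilnorAnnals1963, §7, p. 529 (definition of σₘ)] -/
theorem sigmaGen_mem_sphereSignatureSubgroup (g : Literature.AlgebraicTopology.SingularHomology.HomologicalOrientation ℤ (EuclideanSpace ℝ (Fin n)) n)
    (m : ℕ) (h : n + 1 = 4 * m) :
    ((sigmaGen g m h : ℕ) : ℤ) ∈ sphereSignatureSubgroup g m h := by
  by_cases hex : ∃ x ∈ sphereSignatureSubgroup g m h, x ≠ 0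
  · obtain ⟨x, hx, hx0⟩ := hex
    exact (sigmaGen_pos_and_mem hx hx0).2
  · push Not at hex
    have hempty : {k : ℕ | 0 < k ∧ (k : ℤ) ∈ sphereSignatureSubgroup g m h} = ∅ := by
      refine Set.eq_empty_of_forall_notMem fun k hk => ?_
      have := hex _ hk.2
      have hk0 : (k : ℤ) ≠ 0 := by exact_mod_cast hk.1.ne'
      exact hk0 this
    have h0 : sigmaGen g m h = 0 := by
      rw [sigmaGen, hempty, Nat.sInf_empty]
    rw [h0, Nat.cast_zero]
    exact zero_mem _

/-- **Kervaire–Milnor's group of signatures is `σₘ ℤ`**: the subgroup of `ℤ` generated by the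
signatures of the oriented s-parallelizable `4m`-manifolds bounded by the standard sphere is the
group of multiples of `σₘ = sigmaGen g m h` (p. 529: "Let `σₘ > 0` denote the generator of this
group"). [cite: KervaireMilnorAnnals1963, §7, p. 529 (definition of σₘ)] -/
theorem sphereSignatureSubgroup_eq_zmultiples (g : Literature.AlgebraicTopology.SingularHomology.HomologicalOrientation ℤ (EuclideanSpace ℝ (Fin n)) n)
    (m : ℕ) (h : n + 1 = 4 * m) :
    sphereSignatureSubgroup g m h = AddSubgroup.zmultiples ((sigmaGen g m h : ℕ) : ℤ) := by
  refine le_antisymm (fun x hx => ?_)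
    (AddSubgroup.zmultiples_le.2 (sigmaGen_mem_sphereSignatureSubgroup g m h))
  exact Int.mem_zmultiples_iff.2 (sigmaGen_dvd_of_mem_sphereSignatureSubgroup hx)

/-! ### Connected sums of homotopy spheres, unconditionally for `n ≠ 0, 2` -/

/-- **Oriented connected sums of homotopy `n`-spheres exist as homotopy spheres** for `n ≠ 0, 2`,
unconditionally: oriented connected sums of nonempty closed oriented manifolds exist (tree theorem
`exists_isOrientedConnectedSum_holds`, Kosinski VI (1.1)) and the sum of two homotopy `n`-spheres is
a homotopy `n`-sphere (Kervaire–Milnor 1963, §2, p. 505: "It is clear that the sum of two homotopy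
`n`-spheres is a homotopy `n`-sphere"; tree theorem
`HomotopySphere.nonempty_homotopyEquiv_sphere_of_isConnectedSum_of_ne_two`). Unconditional form of
`HomotopySphere.exists_isOrientedConnectedSum_of`. [cite: KervaireMilnorAnnals1963, §2, p. 505] -/
theorem exists_isOrientedConnectedSum_of_ne_two (hn0 : n ≠ 0) (hn2 : n ≠ 2)
    (S T : HomotopySphere n) :
    ∃ U : HomotopySphere n, IsOrientedConnectedSum S.orientation T.orientation U.orientation := by
  haveI := S.nonempty
  haveI := T.nonempty
  obtain ⟨P, _, _, _, _, _, _, oP, hP⟩ :=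
    exists_isOrientedConnectedSum_holds hn0 S.carrier T.carrier S.orientation T.orientation
  obtain ⟨e⟩ :=
    nonempty_homotopyEquiv_sphere_of_isConnectedSum_of_ne_two hn2 S T P hP.isConnectedSum
  exact ⟨⟨P, oP, ⟨e⟩⟩, hP⟩

/-! ### Theorem 7.5, "only if" -/

/-- **Kervaire–Milnor Thm. 7.5, "only if", for a given group structure on `Θₙ`.** Let
`n + 1 = 4m`, `m > 1`, and fix on `Θₙ = HomotopySphereClass n` a commutative group structure whose
product is the connected sum (`IsMul a b c → a * b = c`), whose unit is `[𝕊ⁿ]` (every orientation)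
and whose inverse is orientation reversal (the clauses of
`Literature.Topology.FourManifolds.exists_commGroup_homotopySphereClass`, Kervaire–Milnor Thm. 1.1).
GIVEN `σ(-M) = -σ(M)` (`neg_mem_signatureSet_neg`), additivity of `σ` over connected sums along the
boundary (`add_mem_signatureSet_of_isOrientedConnectedSum`) and Bredon's VI.7.15 on `𝕊ⁿ`
(`SmoothOrientation.existsUnique_isCompatible n 𝕊ⁿ`): if `σ ∈ signatureSet g m h Σ₁`,
`τ ∈ signatureSet g m h Σ₂` and `[Σ₁] = [Σ₂]`, then `σₘ ∣ σ - τ`. Proof (Kervaire–Milnor p. 530,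
without the h-cobordism `W`, see the module docstring): `-σ + τ` is the signature of an oriented
s-parallelizable manifold bounded by `-Σ₁ # Σ₂`, whose class is `[Σ₁]⁻¹ · [Σ₂] = 1 = [𝕊ⁿ]`; transport
along a diffeomorphism `-Σ₁ # Σ₂ ≅ 𝕊ⁿ` puts `-σ + τ` in the group of signatures for the standard
sphere, all of whose elements are multiples of `σₘ`. [cite: KervaireMilnorAnnals1963, Thm. 7.5, proof of "only if" (p. 530)] -/
theorem sigmaGen_dvd_sub_of_mk_eq_mk_of_commGroup (hneg : neg_mem_signatureSet_neg)
    (hadd : add_mem_signatureSet_of_isOrientedConnectedSum) {m : ℕ} (h : n + 1 = 4 * m)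
    (hm : 1 < m) (hB : SmoothOrientation.existsUnique_isCompatible n (Metric.sphere (0 : EuclideanSpace ℝ (Fin (n + 1))) 1))
    [CommGroup (HomotopySphereClass n)]
    (hmul : ∀ a b c : HomotopySphereClass n, HomotopySphereClass.IsMul a b c → a * b = c)
    (hone : ∀ o : SmoothOrientation (𝓡 n) (Metric.sphere (0 : EuclideanSpace ℝ (Fin (n + 1))) 1),
      (HomotopySphereClass.mk ⟨Metric.sphere (0 : EuclideanSpace ℝ (Fin (n + 1))) 1, o, ⟨.refl _⟩⟩ : HomotopySphereClass n) = 1)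
    (hinv : ∀ a : HomotopySphereClass n, a⁻¹ = a.neg)
    (g : Literature.AlgebraicTopology.SingularHomology.HomologicalOrientation ℤ (EuclideanSpace ℝ (Fin n)) n) {S T : HomotopySphere n} {σ τ : ℤ}
    (hσ : σ ∈ signatureSet g m h S) (hτ : τ ∈ signatureSet g m h T)
    (hST : HomotopySphereClass.mk S = HomotopySphereClass.mk T) :
    (sigmaGen g m h : ℤ) ∣ σ - τ := by
  have hn0 : n ≠ 0 := by omega
  have hn2 : n ≠ 2 := by omega
  -- `-σ = σ(-M₁)` occurs for `-Σ₁`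
  have hσ' : -σ ∈ signatureSet g m h S.neg := hneg n m h hm g S σ hσ
  -- the connected sum `-Σ₁ # Σ₂`, a homotopy sphere bounding `(-M₁) # M₂` of signature `-σ + τ`
  obtain ⟨U, hU⟩ := exists_isOrientedConnectedSum_of_ne_two hn0 hn2 S.neg T
  have hsum : -σ + τ ∈ signatureSet g m h U := hadd n m h g S.neg T U hU (-σ) hσ' τ hτ
  -- its class is `[Σ₁]⁻¹ · [Σ₂] = 1 = [𝕊ⁿ]`
  have hmulU : HomotopySphereClass.mk S.neg * HomotopySphereClass.mk T = HomotopySphereClass.mk U :=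
    hmul _ _ _ ⟨S.neg, T, U, rfl, rfl, rfl, hU⟩
  have hU1 : HomotopySphereClass.mk U = 1 := by
    rw [← hmulU, ← HomotopySphereClass.neg_mk, ← hinv, hST, inv_mul_cancel]
  obtain ⟨o₀⟩ := (isOrientable_sphere_holds n : Nonempty _)
  have hUS : HomotopySphereClass.mk U = HomotopySphereClass.mk ⟨Metric.sphere (0 : EuclideanSpace ℝ (Fin (n + 1))) 1, o₀, ⟨.refl _⟩⟩ :=
    hU1.trans (hone o₀).symm
  -- so `-Σ₁ # Σ₂` is diffeomorphic to `𝕊ⁿ`, and `-σ + τ` occurs for the standard sphere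
  obtain ⟨ψ⟩ := HomotopySphereClass.nonempty_diffeomorph_of_mk_eq_mk hUS
  obtain ⟨o, ho⟩ := exists_mem_signatureSet_sphere_of_diffeomorph hn0 hB hsum ψ
  have hdvd : (sigmaGen g m h : ℤ) ∣ -σ + τ :=
    sigmaGen_dvd_of_mem_sphereSignatureSubgroup (mem_sphereSignatureSubgroup ho)
  have hrw : σ - τ = -(-σ + τ) := by ring
  rw [hrw]
  exact (dvd_neg).2 hdvd

/-- **Kervaire–Milnor Thm. 7.5, "only if", in dimension `n`, from the class-level group laws of
`Θₙ`** (`HomotopySphereClass.GroupLawFacts n`, `HomotopySpheresGroup.lean`: products exist and are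
unique and associative, `[𝕊ⁿ]` is a unit, `[Σ] · [-Σ] = [𝕊ⁿ]` — Kervaire–Milnor Lemmas 2.1–2.4 with
Smale — whence a group structure, `GroupLawFacts.exists_commGroup`, proved in the tree), together
with `σ(-M) = -σ(M)`, §2-additivity and Bredon VI.7.15 on `𝕊ⁿ`, as in
`sigmaGen_dvd_sub_of_mk_eq_mk_of_commGroup`. [cite: KervaireMilnorAnnals1963, Thm. 7.5, proof of "only if" (p. 530), with Lemmas 2.1–2.4] -/
theorem sigmaGen_dvd_sub_of_mk_eq_mk_of_groupLawFacts (hG : HomotopySphereClass.GroupLawFacts n)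
    (hneg : neg_mem_signatureSet_neg) (hadd : add_mem_signatureSet_of_isOrientedConnectedSum)
    {m : ℕ} (h : n + 1 = 4 * m) (hm : 1 < m)
    (hB : SmoothOrientation.existsUnique_isCompatible n (Metric.sphere (0 : EuclideanSpace ℝ (Fin (n + 1))) 1))
    (g : Literature.AlgebraicTopology.SingularHomology.HomologicalOrientation ℤ (EuclideanSpace ℝ (Fin n)) n) {S T : HomotopySphere n} {σ τ : ℤ}
    (hσ : σ ∈ signatureSet g m h S) (hτ : τ ∈ signatureSet g m h T)
    (hST : HomotopySphereClass.mk S = HomotopySphereClass.mk T) :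
    (sigmaGen g m h : ℤ) ∣ σ - τ := by
  obtain ⟨o₀⟩ := (isOrientable_sphere_holds n : Nonempty _)
  obtain ⟨inst, hmul, hone, hinv⟩ := hG.exists_commGroup o₀
  exact sigmaGen_dvd_sub_of_mk_eq_mk_of_commGroup hneg hadd h hm hB hmul hone hinv g hσ hτ hST

/-- **Kervaire–Milnor Thm. 7.5, "only if"** (*Groups of homotopy spheres I* (1963), p. 530), in the
binder shape of the named fact `mk_eq_mk_iff_sigmaGen_dvd_sub`: GIVEN Thm. 1.1
(`Literature.Topology.FourManifolds.exists_commGroup_homotopySphereClass`: `Θₙ` is a commutative group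
under connected sum with unit `[𝕊ⁿ]` and inverse `[-Σ]`, `n ≠ 0, 4`), `σ(-M) = -σ(M)`
(`neg_mem_signatureSet_neg`), additivity of `σ` over connected sums along the boundary
(`add_mem_signatureSet_of_isOrientedConnectedSum`) and Bredon's VI.7.15 on the standard spheres
(`SmoothOrientation.existsUnique_isCompatible k 𝕊ᵏ`), for `n + 1 = 4m`, `m > 1`, homotopy spheres
`Σ₁`, `Σ₂` bounding oriented s-parallelizable `M₁`, `M₂` with `σ(M₁) = σ`, `σ(M₂) = τ`:
`[Σ₁] = [Σ₂]` in `Θₙ` implies `σ ≡ τ mod σₘ`. The converse ("if", via Lemma 7.3) is not proved in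
the tree. [cite: KervaireMilnorAnnals1963, Thm. 7.5 (pp. 529–530), "only if"] -/
theorem sigmaGen_dvd_sub_of_mk_eq_mk_of (hgrp : exists_commGroup_homotopySphereClass)
    (hneg : neg_mem_signatureSet_neg) (hadd : add_mem_signatureSet_of_isOrientedConnectedSum)
    (hB : ∀ k : ℕ, SmoothOrientation.existsUnique_isCompatible k (Metric.sphere (0 : EuclideanSpace ℝ (Fin (k + 1))) 1)) :
    ∀ (n m : ℕ) (h : n + 1 = 4 * m), 1 < m →
      ∀ (g : Literature.AlgebraicTopology.SingularHomology.HomologicalOrientation ℤ (EuclideanSpace ℝ (Fin n)) n) (S T : HomotopySphere n) (σ τ : ℤ),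
        σ ∈ signatureSet g m h S → τ ∈ signatureSet g m h T →
          HomotopySphereClass.mk S = HomotopySphereClass.mk T → (sigmaGen g m h : ℤ) ∣ σ - τ := by
  intro n m h hm g S T σ τ hσ hτ hST
  obtain ⟨inst, hmul, hone, hinv⟩ := hgrp n (by omega) (by omega)
  exact sigmaGen_dvd_sub_of_mk_eq_mk_of_commGroup hneg hadd h hm (hB n) hmul hone hinv g hσ hτ hST

/-- **Kervaire–Milnor Thm. 7.5, "only if", over the current frontier of named facts**: as
`sigmaGen_dvd_sub_of_mk_eq_mk_of`, with `σ(-M) = -σ(M)` supplied by Milnor's Prop. B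
(`nonempty_homeomorph_sphere_of_homologySphere_of_five_le`, *Lectures on the h-cobordism theorem*
(1965), §9, Prop. B, through the tree theorem `HomotopySphere.neg_mem_signatureSet_neg_of_propB`).
The remaining hypotheses — Thm. 1.1, §2-additivity of `σ` over connected sums along the boundary,
Bredon VI.7.15 on `𝕊ᵏ`, Prop. B — are named facts of the tree. [cite: KervaireMilnorAnnals1963, Thm. 7.5 (pp. 529–530), "only if"] [cite: MilnorHCobordism1965, §9, Prop. B (p. 109)] -/
theorem sigmaGen_dvd_sub_of_mk_eq_mk_of_propB (hgrp : exists_commGroup_homotopySphereClass)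
    (hPB : nonempty_homeomorph_sphere_of_homologySphere_of_five_le.{0})
    (hadd : add_mem_signatureSet_of_isOrientedConnectedSum)
    (hB : ∀ k : ℕ, SmoothOrientation.existsUnique_isCompatible k (Metric.sphere (0 : EuclideanSpace ℝ (Fin (k + 1))) 1)) :
    ∀ (n m : ℕ) (h : n + 1 = 4 * m), 1 < m →
      ∀ (g : Literature.AlgebraicTopology.SingularHomology.HomologicalOrientation ℤ (EuclideanSpace ℝ (Fin n)) n) (S T : HomotopySphere n) (σ τ : ℤ),
        σ ∈ signatureSet g m h S → τ ∈ signatureSet g m h T →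
          HomotopySphereClass.mk S = HomotopySphereClass.mk T → (sigmaGen g m h : ℤ) ∣ σ - τ :=
  sigmaGen_dvd_sub_of_mk_eq_mk_of hgrp (neg_mem_signatureSet_neg_of_propB hPB) hadd hB

end HomotopySphere

section Lemma34Appended

open Module Bundle

/-! ### Kervaire–Milnor's Lemma 3.4: s-parallelizable bounding manifolds are parallelizable (appended) -/

namespace NullCobordism

section Component

variable {n : ℕ} {M : Type} [TopologicalSpace M] [ChartedSpace (EuclideanSpace ℝ (Fin n)) M]

/-- **The component of the boundary.** A null-cobordism `M = ∂W` of a connected `M` restricts to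
a null-cobordism `M = ∂W₀` by the connected component `W₀` of `W` containing `∂W` (an open and
closed submanifold, `TW₀ = TW|_{W₀}`); if `W` is s-parallelizable so is `W₀`
(Kervaire–Milnor 1963, proof of Cor. 7.6 / Lemma 3.4: "applied to the component of `M`
containing `bM`"). [folklore] -/
theorem exists_connectedSpace_isStablyParallelizable [IsManifold (𝓡 n) ∞ M] [ConnectedSpace M]
    (c : NullCobordism n M) (h : IsStablyParallelizable (𝓡∂ (n + 1)) c.W) :
    ∃ c' : NullCobordism n M, ConnectedSpace c'.W ∧ IsStablyParallelizable (𝓡∂ (n + 1)) c'.W := by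
  obtain ⟨x₀⟩ := (inferInstance : Nonempty M)
  haveI : LocallyConnectedSpace c.W :=
    ChartedSpace.locallyConnectedSpace (EuclideanHalfSpace (n + 1)) c.W
  set U : TopologicalSpace.Opens c.W := ⟨connectedComponent (c.incl x₀), isOpen_connectedComponent⟩
    with hU
  haveI hUc : CompactSpace U := isCompact_iff_compactSpace.1 isClosed_connectedComponent.isCompact
  haveI hUconn : ConnectedSpace U :=
    isConnected_iff_connectedSpace.1 isConnected_connectedComponent
  have hmem : ∀ x : M, c.incl x ∈ U := fun x ↦
    (isPreconnected_range c.continuous_incl).subset_connectedComponent (mem_range_self x₀)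
      (mem_range_self x)
  have hrange : range (fun x ↦ (⟨c.incl x, hmem x⟩ : U)) = (𝓡∂ (n + 1)).boundary U := by
    ext a
    rw [mem_boundary_opens_iff, ← c.range_incl]
    constructor
    · rintro ⟨x, rfl⟩; exact ⟨x, rfl⟩
    · rintro ⟨x, hx⟩; exact ⟨x, Subtype.ext hx⟩
  refine ⟨{ W := U
            incl := fun x ↦ ⟨c.incl x, hmem x⟩
            isSmoothEmbedding_incl := c.isSmoothEmbedding_incl.codRestrict_opens U hmem
            range_incl := hrange }, hUconn, ?_⟩
  have h2 : HasStableTangentFramingAlong (𝓡∂ (n + 1)) c.W (Subtype.val ∘ (id : U → U)) :=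
    h.comp ⟨Subtype.val, continuous_subtype_val⟩
  exact HasStableTangentFramingAlong.of_comp_subtype_val U continuous_id h2

end Component

section Lemma34

variable {n : ℕ} {M : Type} [TopologicalSpace M] [ChartedSpace (EuclideanSpace ℝ (Fin (n + 1))) M]

/-- **Kervaire–Milnor's Lemma 3.4** (*Groups of homotopy spheres I* (1963), p. 509: "A connected
manifold with non-vacuous boundary is s-parallelizable if and only if it is parallelizable"),
non-trivial direction, for the total space of a null-cobordism `M = ∂W` of a non-empty closed
`M` with `W` connected (compact, dimension `n + 2`): a stable framing `sᵢ = (vᵢ, aᵢ)` of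
`TW ⊕ ℝ` has Gauss map `â = a/‖a‖ : W → Sⁿ⁺²`, which is null-homotopic because `W` is a compact
connected manifold with non-empty boundary (`exists_homotopy_of_sphereValued`,
`MapsToSphereNullhomotopic.lean`), so the framing lifts to a framing of `TW`
(`hasTangentFramingAlong_of_homotopic_const`, `StableFramingLift.lean`, the mechanism of
Lemma 3.5). [cite: KervaireMilnorAnnals1963, Lemma 3.4 (p. 509)] -/
theorem isParallelizable_of_isStablyParallelizable [IsManifold (𝓡 (n + 1)) ∞ M] [Nonempty M]
    [CompactSpace M] (c : NullCobordism (n + 1) M) [ConnectedSpace c.W]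
    (h : IsStablyParallelizable (𝓡∂ (n + 1 + 1)) c.W) : IsParallelizable (𝓡∂ (n + 1 + 1)) c.W := by
  obtain ⟨s, hs, hs', hli⟩ := h
  -- the coefficient vector `a` of the projection `TW ⊕ ℝ → ℝ` never vanishes
  have ha0 : ∀ p, (WithLp.toLp 2 fun i ↦ (s i p).2 :
      EuclideanSpace ℝ (Fin (finrank ℝ (EuclideanSpace ℝ (Fin (n + 1 + 1))) + 1))) ≠ 0 := by
    intro p hp
    have h0 : ∀ i, (s i p).2 = 0 := fun i ↦ by
      have := congrArg
        (fun v : EuclideanSpace ℝ (Fin (finrank ℝ (EuclideanSpace ℝ (Fin (n + 1 + 1))) + 1)) ↦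
          v i) hp
      simpa using this
    have hli' : LinearIndependent ℝ fun i ↦ (s i p).1 := by
      refine LinearIndependent.of_comp (LinearMap.inl ℝ (EuclideanSpace ℝ (Fin (n + 1 + 1))) ℝ) ?_
      convert hli p using 1
      funext i
      exact Prod.ext rfl (h0 i).symm
    have hcard := hli'.fintype_card_le_finrank
    rw [Fintype.card_fin] at hcard
    omega
  have hac : Continuous fun p ↦ (WithLp.toLp 2 fun i ↦ (s i p).2 :
      EuclideanSpace ℝ (Fin (finrank ℝ (EuclideanSpace ℝ (Fin (n + 1 + 1))) + 1))) :=
    (PiLp.continuous_toLp 2 _).comp (continuous_pi fun i ↦ hs' i)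
  -- the Gauss map `â` and its null-homotopy
  set φ : c.W → EuclideanSpace ℝ (Fin (finrank ℝ (EuclideanSpace ℝ (Fin (n + 1 + 1))) + 1)) :=
    fun p ↦ ‖(WithLp.toLp 2 fun i ↦ (s i p).2 :
      EuclideanSpace ℝ (Fin (finrank ℝ (EuclideanSpace ℝ (Fin (n + 1 + 1))) + 1)))‖⁻¹ •
        (WithLp.toLp 2 fun i ↦ (s i p).2) with hφ
  have hφc : Continuous φ := (hac.norm.inv₀ fun p ↦ norm_ne_zero_iff.2 (ha0 p)).smul hac
  have hφ1 : ∀ p, ‖φ p‖ = 1 := fun p ↦ norm_smul_inv_norm (ha0 p)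
  haveI : Nonempty c.boundaryData.carrier := inferInstanceAs (Nonempty M)
  haveI : CompactSpace c.boundaryData.carrier := inferInstanceAs (CompactSpace M)
  have hdim : n + 1 + 1 <
      finrank ℝ (EuclideanSpace ℝ (Fin (finrank ℝ (EuclideanSpace ℝ (Fin (n + 1 + 1))) + 1))) := by
    simp
  have he : ‖(EuclideanSpace.single (Fin.last (finrank ℝ (EuclideanSpace ℝ (Fin (n + 1 + 1)))))
      (1 : ℝ) : EuclideanSpace ℝ (Fin (finrank ℝ (EuclideanSpace ℝ (Fin (n + 1 + 1))) + 1)))‖ =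
      1 := by
    simp
  obtain ⟨G, hGc, hG1, hG0, hGφ⟩ :=
    exists_homotopy_of_sphereValued c.boundaryData hdim φ hφc hφ1 he
  exact hasTangentFramingAlong_of_homotopic_const continuous_id s hs hli G hGc hG1 hG0 hGφ

end Lemma34

end NullCobordism

namespace HomotopySphere

/-- **Discharge of `HomotopySphere.boundsParallelizable_of_mem_signatureSet`** (Kervaire–Milnor
1963, Lemma 3.4 with §4): if `σ ∈ signatureSet g m h Σ` — so `Σ = bM` for a compact
s-parallelizable `M` — then `Σ` bounds a parallelizable manifold: the component `M₀` of `M`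
containing `bM = Σ` (connected, `n ≥ 1`) is a compact connected s-parallelizable manifold with
non-vacuous boundary `Σ` (`NullCobordism.exists_connectedSpace_isStablyParallelizable`), hence
parallelizable by Lemma 3.4 (`NullCobordism.isParallelizable_of_isStablyParallelizable`).
[cite: KervaireMilnorAnnals1963, Lemma 3.4 (p. 509), with §4 (definition of bP_{n+1})] -/
theorem boundsParallelizable_of_mem_signatureSet_holds : boundsParallelizable_of_mem_signatureSet := by
  intro n m h g S σ hσ
  obtain ⟨μ, c, μ', -, hspar, -, -⟩ := hσ
  obtain ⟨n, rfl⟩ : ∃ n', n = n' + 1 := ⟨n - 1, by omega⟩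
  haveI := S.connectedSpace (by omega)
  haveI := S.nonempty
  obtain ⟨c', hconn, hspar'⟩ := c.exists_connectedSpace_isStablyParallelizable hspar
  haveI := hconn
  exact ⟨c', c'.isParallelizable_of_isStablyParallelizable hspar'⟩

end HomotopySphere

end Lemma34Appended


section NonemptySignatureSetAppended

/-! ### Kervaire–Milnor §4/§7: a homotopy sphere bounding a parallelizable manifold bounds an oriented s-parallelizable one (appended)

Discharge of the named fact
`Literature.Topology.FourManifolds.HomotopySphere.nonempty_signatureSet_of_boundsParallelizable`
(`HomotopySpheresSignature.lean`): if `Σ = bW` with `W` parallelizable (the definition of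
`bPₙ₊₁`, Kervaire–Milnor 1963, §4) then `signatureSet g m h Σ` is nonempty (the hypothesis "`Σ`
bounds an s-parallelizable manifold" of Thm. 7.5, with all orientations made explicit). In the
paper this is invisible: "all manifolds are to be compact, oriented" (p. 504) and parallelizable
implies s-parallelizable (§3). Here:

* the component `W₀` of `W` containing `bW = Σ` is a connected compact smooth manifold with
  `bW₀ = Σ`, s-parallelizable (`IsParallelizable.isStablyParallelizable`, restricted to the open
  submanifold `W₀`) and smoothly orientable (`IsParallelizable.isOrientable`, Lee Prop. 15.17, and
  `IsOrientable.opens`) — `NullCobordism.exists_connectedSpace_isStablyParallelizable_isOrientable`;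
* Bredon VI.7.15 (`SmoothOrientation.existsUnique_isCompatible_holds`) gives the homological
  orientation `μ` of `Σ` compatible with its smooth one;
* a smoothly oriented null-cobordism has a relative fundamental class `z ∈ Hₙ₊₁(W₀, ∂W₀; ℤ)`
  (`NullCobordism.exists_isRelFundamentalClass_of_smoothOrientation`, Hatcher p. 253);
* `∂z` is the fundamental class of the boundary orientation of `∂W₀ ≅ Σ` (Spanier Cor. 6.3.10,
  `boundaryOrientation_fundamentalClass_eq`), which is `±μ` since `Σ` is connected (Hatcher
  Prop. 3.25 ff., `eq_or_eq_neg_of_connected_holds`); replacing `z` by `-z` if necessary,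
  `∂z = incl⁎ [Σ]_μ` (`NullCobordism.exists_isRelFundamentalClass_δ_eq`);
* the closed model `W₀ ∪ cone(∂W₀)` carries a homological orientation `μ'` with
  `q⁎ z = j⁎ [Ŵ₀]_{μ'}` (`NullCobordism.exists_orientation_closedModel_of_isRelFundamentalClass`,
  Kervaire–Milnor footnote pp. 528–529), so `(Σ, μ) = bW₀` as oriented manifolds
  (`NullCobordism.IsOrientedBy`) and `σ(W₀) ∈ signatureSet g m h Σ`.
-/

namespace NullCobordism

variable {n : ℕ} {M : Type} [TopologicalSpace M] [ChartedSpace (EuclideanSpace ℝ (Fin n)) M]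

/-- **The component of the boundary of a parallelizable null-cobordism** is a connected,
s-parallelizable, smoothly orientable null-cobordism of the same (connected) `M`
(Kervaire–Milnor 1963, p. 504: "all manifolds … oriented"; §3: parallelizable ⇒ s-parallelizable;
Lee 2013, Prop. 15.17: parallelizable ⇒ orientable). [cite: KervaireMilnorAnnals1963, §4 (definition of bP_{n+1}) and p. 504] -/
theorem exists_connectedSpace_isStablyParallelizable_isOrientable [IsManifold (𝓡 n) ∞ M]
    [ConnectedSpace M] (c : NullCobordism n M) (h : IsParallelizable (𝓡∂ (n + 1)) c.W) :
    ∃ c' : NullCobordism n M, ConnectedSpace c'.W ∧ IsStablyParallelizable (𝓡∂ (n + 1)) c'.W ∧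
      IsOrientable (𝓡∂ (n + 1)) c'.W := by
  obtain ⟨x₀⟩ := (inferInstance : Nonempty M)
  haveI : LocallyConnectedSpace c.W :=
    ChartedSpace.locallyConnectedSpace (EuclideanHalfSpace (n + 1)) c.W
  set U : TopologicalSpace.Opens c.W := ⟨connectedComponent (c.incl x₀), isOpen_connectedComponent⟩
    with hU
  haveI hUc : CompactSpace U := isCompact_iff_compactSpace.1 isClosed_connectedComponent.isCompact
  haveI hUconn : ConnectedSpace U :=
    isConnected_iff_connectedSpace.1 isConnected_connectedComponent
  have hmem : ∀ x : M, c.incl x ∈ U := fun x ↦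
    (isPreconnected_range c.continuous_incl).subset_connectedComponent (mem_range_self x₀)
      (mem_range_self x)
  have hrange : range (fun x ↦ (⟨c.incl x, hmem x⟩ : U)) = (𝓡∂ (n + 1)).boundary U := by
    ext a
    rw [mem_boundary_opens_iff, ← c.range_incl]
    constructor
    · rintro ⟨x, rfl⟩; exact ⟨x, rfl⟩
    · rintro ⟨x, hx⟩; exact ⟨x, Subtype.ext hx⟩
  refine ⟨{ W := U
            incl := fun x ↦ ⟨c.incl x, hmem x⟩
            isSmoothEmbedding_incl := c.isSmoothEmbedding_incl.codRestrict_opens U hmem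
            range_incl := hrange }, hUconn, ?_, (h.isOrientable).opens U⟩
  have h2 : HasStableTangentFramingAlong (𝓡∂ (n + 1)) c.W (Subtype.val ∘ (id : U → U)) :=
    h.isStablyParallelizable.comp ⟨Subtype.val, continuous_subtype_val⟩
  exact HasStableTangentFramingAlong.of_comp_subtype_val U continuous_id h2

variable {m : ℕ} {N : Type} [TopologicalSpace N] [T2Space N] [ChartedSpace (EuclideanSpace ℝ (Fin (m + 1))) N]
  [CompactSpace N] [ConnectedSpace N]

/-- **Sign glue: a relative fundamental class inducing a prescribed orientation of the boundary.**
For a null-cobordism `Σ = ∂W` of a closed connected `Σ` (dimension `m + 1`), a homological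
`ℤ`-orientation `μ` of `Σ` and a relative fundamental class `z` of `(W, ∂W)`, one of `z`, `-z` has
boundary `incl⁎ [Σ]_μ`: `∂z` is the fundamental class of the boundary orientation (Spanier
Cor. 6.3.10, `boundaryOrientation_fundamentalClass_eq`), whose transport to `Σ` is `μ` or `-μ`
(Hatcher 2002, Prop. 3.25 ff.: a connected manifold has exactly two orientations,
`eq_or_eq_neg_of_connected_holds`; `fundamentalClass_comap_holds`, `fundamentalClass_neg_holds`).
[cite: HatcherAT2002, §3.3 p. 253 ("∂[M] = [∂M]") and Prop. 3.25 ff.] -/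
theorem exists_isRelFundamentalClass_δ_eq (c : NullCobordism (m + 1) N)
    (μ : Literature.AlgebraicTopology.SingularHomology.HomologicalOrientation ℤ N (m + 1))
    {z : Literature.AlgebraicTopology.SingularHomology.relativeSingularHomology ℤ ℤ c.W
      ((𝓡∂ (m + 1 + 1)).boundary c.W) (m + 1 + 1)}
    (hz : Literature.AlgebraicTopology.SingularHomology.IsRelFundamentalClass ℤ ((𝓡∂ (m + 1 + 1)).boundary c.W) z) :
    ∃ z' : Literature.AlgebraicTopology.SingularHomology.relativeSingularHomology ℤ ℤ c.W
        ((𝓡∂ (m + 1 + 1)).boundary c.W) (m + 1 + 1),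
      Literature.AlgebraicTopology.SingularHomology.IsRelFundamentalClass ℤ ((𝓡∂ (m + 1 + 1)).boundary c.W) z' ∧
        Literature.AlgebraicTopology.SingularHomology.relativeSingularHomology.δ ℤ ℤ c.W
            ((𝓡∂ (m + 1 + 1)).boundary c.W) (m + 1) z' =
          Literature.AlgebraicTopology.SingularHomology.singularHomology.map ℤ ℤ
            (boundaryCorestrict (m + 1) c.inclMap c.incl_mem_boundary) (m + 1) μ.fundamentalClass := by
  have hn : m + 1 ≠ 0 := Nat.succ_ne_zero m
  haveI : CompactSpace ↥((𝓡∂ (m + 1 + 1)).boundary c.W) :=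
    isCompact_iff_compactSpace.1 (ModelWithCorners.isClosed_boundary (I := 𝓡∂ (m + 1 + 1)) (M := c.W)
      (n := 1) one_ne_zero).isCompact
  set μB := Literature.AlgebraicTopology.SingularHomology.boundaryOrientation ℤ hn hz with hμB
  set e := c.inclHomeomorph with he
  -- `∂z = [∂W]_{μB} = e⁎ [Σ]_{μB.comap e}`
  have hδ : Literature.AlgebraicTopology.SingularHomology.relativeSingularHomology.δ ℤ ℤ c.W
      ((𝓡∂ (m + 1 + 1)).boundary c.W) (m + 1) z = μB.fundamentalClass :=
    (Literature.AlgebraicTopology.SingularHomology.boundaryOrientation_fundamentalClass_eq ℤ hn hz).symm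
  have hcomap : (μB.comap e).fundamentalClass =
      (Literature.AlgebraicTopology.SingularHomology.singularHomology.mapIso ℤ ℤ e (m + 1)).inv μB.fundamentalClass :=
    Literature.AlgebraicTopology.SingularHomology.HomologicalOrientation.fundamentalClass_comap_holds ℤ
      (↥((𝓡∂ (m + 1 + 1)).boundary c.W)) N (m + 1) μB e
  have hmap : Literature.AlgebraicTopology.SingularHomology.singularHomology.map ℤ ℤ
      (boundaryCorestrict (m + 1) c.inclMap c.incl_mem_boundary) (m + 1) (μB.comap e).fundamentalClass =
      μB.fundamentalClass := by
    have hee : (e : C(N, ↥((𝓡∂ (m + 1 + 1)).boundary c.W))) =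
        boundaryCorestrict (m + 1) c.inclMap c.incl_mem_boundary := by
      ext x : 2
      rfl
    rw [hcomap, ← hee, ← Literature.AlgebraicTopology.SingularHomology.singularHomology.mapIso_hom,
      ← ModuleCat.comp_apply, CategoryTheory.Iso.inv_hom_id, ModuleCat.id_apply]
  -- `μB.comap e = ± μ`
  rcases Literature.AlgebraicTopology.SingularHomology.HomologicalOrientation.eq_or_eq_neg_of_connected_holds
    N (μB.comap e) μ with hμ | hμ
  · refine ⟨z, hz, ?_⟩
    rw [hδ, ← hmap, hμ]
  · refine ⟨-z, hz.neg, ?_⟩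
    rw [map_neg, hδ, ← hmap, hμ,
      Literature.AlgebraicTopology.SingularHomology.HomologicalOrientation.fundamentalClass_neg_holds ℤ N (m + 1) μ,
      map_neg, neg_neg]

end NullCobordism

namespace HomotopySphere

/-- **Discharge of `HomotopySphere.nonempty_signatureSet_of_boundsParallelizable`**
(Kervaire–Milnor, *Groups of homotopy spheres I* (1963), §4 (definition of `bPₙ₊₁`, p. 510) with
§7 (hypothesis of Thm. 7.5, p. 529) and the standing convention p. 504 "all manifolds are to be
compact, oriented"): if the homotopy `n`-sphere `Σ` (`n + 1 = 4m`) bounds a parallelizable `W`,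
then `signatureSet g m h Σ` is nonempty — the component `W₀ ∋ Σ` is a connected s-parallelizable
smoothly oriented null-cobordism of `Σ`; it has a relative fundamental class `z` with
`∂z = incl⁎ [Σ]_μ` for the homological orientation `μ` of `Σ` compatible with its smooth one
(Bredon VI.7.15), and the closed model `W₀ ∪ cone(Σ)` is oriented by `μ'` with
`q⁎ z = j⁎ [Ŵ₀]_{μ'}` (footnote pp. 528–529), so `σ(W₀) = μ'.signatureInDim ∈ signatureSet g m h Σ`.
[cite: KervaireMilnorAnnals1963, §4 (definition of bP_{n+1}, p. 510) and §7 (Thm. 7.5, hypothesis; footnote pp. 528–529)] [cite: HatcherAT2002, §3.3 p. 253 and Prop. 2.22] -/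
theorem nonempty_signatureSet_of_boundsParallelizable_holds :
    nonempty_signatureSet_of_boundsParallelizable := by
  intro n m h g S hS
  obtain ⟨n, rfl⟩ : ∃ n', n = n' + 1 := ⟨n - 1, by omega⟩
  haveI := S.connectedSpace (by omega)
  haveI := S.nonempty
  obtain ⟨c₀, hpar⟩ := hS
  obtain ⟨c, hconn, hspar, hor⟩ := c₀.exists_connectedSpace_isStablyParallelizable_isOrientable hpar
  haveI := hconn
  obtain ⟨o⟩ := hor
  -- the compatible homological orientation of `Σ` (Bredon VI.7.15)
  obtain ⟨μ, hμ, -⟩ :=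
    SmoothOrientation.existsUnique_isCompatible_holds (n := n + 1) (M := S.carrier) g S.orientation
  -- the relative fundamental class of the oriented `W₀`, with `∂z = incl⁎ [Σ]_μ`
  obtain ⟨z₀, hz₀⟩ := c.exists_isRelFundamentalClass_of_smoothOrientation o
  obtain ⟨z, hz, hδ⟩ := c.exists_isRelFundamentalClass_δ_eq μ hz₀
  -- the orientation of the closed model
  obtain ⟨μ', hμ'⟩ := c.exists_orientation_closedModel_of_isRelFundamentalClass hz
  exact ⟨_, μ, c, μ', hμ, hspar, ⟨z, hδ, hμ'⟩, rfl⟩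

end HomotopySphere

end NonemptySignatureSetAppended

end Literature.Topology.FourManifolds

end
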